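import Mathlib
import Summits.NavierStokesRegularity.NavierStokesRegularity.Theorems.FilamentSkeletonRssKelvinGateRieszWeight
import Literature.Analysis.FluidPDE.NewtonPotentialGradientFarField
import Literature.Analysis.FluidPDE.BiotSavartNewtonKernel

/-!
# Route `FilamentSkeletonRss` · cruxes `TransverseReductionRJ` (stmt-21221, aside) / `TransverseReduction1A` (stmt-27414) —
# line `kelvin_gate`: WEIGHTED HÖLDER MODULUS of the dipole potential from kernel SMOOTHNESS (no cancellation)

Helper file (theorems only, `--as helper`).  HONEST FRAMING: analysis bookkeeping for a HYPOTHETICAL filament-type rotating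
self-similar blow-up route; nothing here bears on Navier–Stokes regularity; no stub is proved here.

Piece (m2) of SHARP-WEIGHTS-DESIGN-21221-g7: for a Banach-valued density with `(1+|y|)^k ‖g‖ ≤ R`, `2 ≤ k < 3`, `0 < γ < 1`, and points
with `4|x − x′| ≤ 1+|x|`,

  `‖T_a g(x) − T_a g(x′)‖ ≤ C_{k,γ} ‖a‖ R |x − x′|^γ (1+|x|)^{1−γ−k}`

(`T_a g = ∫ ∂ₐΓ(x−y)•g(y)dy`).  Proof: split at `|x − y| = 2|x − x′|`; near the two poles the kernel SIZE `|∂Γ| ≤ (4π)⁻¹r⁻²` and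
`∫_{B_r}|w|⁻² = Vr`; far away the increment bound `‖DΓ(z − w) − DΓ(z)‖ ≤ 8|w|/(π|z|³)` (`norm_fderiv_newtonKernel_sub_sub_le`,
Gilbarg–Trudinger (2.14)) and `|z|⁻³ ≤ (2d)^{γ−1}|z|^{-(2+γ)}` against the weighted Riesz integral of `…KelvinGateRieszWeight` with
`p = 2 + γ`.  Only size and smoothness of the kernel are used — this is the "GT Lemma 4.1 with polynomial weights" the free Kelvin gate needs.
-/

set_option linter.dupNamespace false

noncomputable section

namespace Summit.NavierStokesRegularity.NavierStokesRegularity.Theorems.KelvinGate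

open Set Function Filter MeasureTheory Metric Real
open Literature.Analysis.FluidPDE Literature.Analysis.FluidPDE.NewtonPotentialHolder
open scoped ENNReal Topology

/-- Kernel size at every point (junk value `0` at the pole included): `‖DΓ(z)a‖ ≤ (‖a‖/4π) |z|⁻²`. -/
theorem norm_fderiv_newtonKernel_apply_le (z a : EuclideanSpace ℝ (Fin 3)) :
    ‖fderiv ℝ newtonKernel z a‖ ≤ ‖a‖ / (4 * π) * ‖z‖ ^ (-(2:ℝ)) := by
  by_cases hz : z = 0
  · subst hz
    rw [fderiv_newtonKernel_zero, zero_apply, norm_zero]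
    positivity
  · have hpos : 0 < ‖z‖ := norm_pos_iff.2 hz
    calc ‖fderiv ℝ newtonKernel z a‖ ≤ ‖fderiv ℝ newtonKernel z‖ * ‖a‖ := ContinuousLinearMap.le_opNorm _ _
      _ = ‖a‖ / (4 * π) * ‖z‖ ^ (-(2:ℝ)) := by
          rw [norm_fderiv_newtonKernel hz, rpow_neg hpos.le, rpow_two]; field_simp

section Banach

variable {G : Type*} [NormedAddCommGroup G] [NormedSpace ℝ G]

set_option maxHeartbeats 400000 in
/-- **Weighted Hölder modulus of the dipole potential** (kernel size + smoothness only): there is `C = C(k, γ)` such that for every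
measurable density with `(1+|y|)^k‖g‖ ≤ R` (`2 ≤ k < 3`), every direction `a` and all `x, x′` with `4|x − x′| ≤ 1 + |x|`,
`‖T_a g(x) − T_a g(x′)‖ ≤ C ‖a‖ R |x − x′|^γ (1+|x|)^{1−γ−k}` (`0 < γ < 1`). -/
theorem exists_norm_newtonGradPotential_sub_le_of_weight_rpow {k γ : ℝ} (hk2 : 2 ≤ k) (hk3 : k < 3) (hγ0 : 0 < γ) (hγ1 : γ < 1) :
    ∃ C : ℝ, 0 ≤ C ∧ ∀ {g : EuclideanSpace ℝ (Fin 3) → G} {R : ℝ}, AEStronglyMeasurable g volume →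
      (∀ y, (1 + ‖y‖) ^ k * ‖g y‖ ≤ R) → ∀ (a x x' : EuclideanSpace ℝ (Fin 3)), 4 * ‖x - x'‖ ≤ 1 + ‖x‖ →
        ‖newtonGradPotential a g x - newtonGradPotential a g x'‖ ≤
          C * ‖a‖ * R * ‖x - x'‖ ^ γ * (1 + ‖x‖) ^ (1 - γ - k) := by
  set V : ℝ := 3 * (volume : Measure (EuclideanSpace ℝ (Fin 3))).real (ball 0 1) with hV
  have hV0 : 0 ≤ V := three_mul_volume_real_ball_nonneg
  have h3p : 0 < 3 - (2 + γ) := by linarith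
  have h3k : 0 < 3 - k := by linarith
  have hpk : 0 < 2 + γ + k - 3 := by linarith
  set Cfar : ℝ := (2:ℝ) ^ (2 + γ + k - 3) / (3 - (2 + γ)) + (2:ℝ) ^ (2 + γ + 3 - k) / (3 - k) +
    (2:ℝ) ^ (3 - k) / (2 + γ + k - 3) with hCfar
  have hCfar0 : 0 ≤ Cfar := by positivity
  set Cn : ℝ := 5 * (2:ℝ) ^ k * (4:ℝ) ^ (γ - 1) * V / (4 * π) with hCn
  set Cf : ℝ := 8 / π * (2:ℝ) ^ (γ - 1) * Cfar * V with hCf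
  have hCn0 : 0 ≤ Cn := by positivity
  have hCf0 : 0 ≤ Cf := by positivity
  refine ⟨Cn + Cf, by positivity, ?_⟩
  intro g R hgm hg a x x' hxx'
  have hR : 0 ≤ R := le_trans (by positivity) (hg 0)
  set ρ : ℝ := 1 + ‖x‖ with hρ
  have hρ0 : 0 < ρ := by rw [hρ]; linarith [norm_nonneg x]
  set d : ℝ := ‖x - x'‖ with hd
  have hd0 : 0 ≤ d := norm_nonneg _
  -- trivial case `x = x'`
  rcases hd0.eq_or_lt with hdz | hdpos
  · have hxe : x - x' = 0 := norm_eq_zero.1 hdz.symm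
    rw [sub_eq_zero] at hxe
    subst hxe
    rw [sub_self, norm_zero]
    positivity
  have h2d : 0 < 2 * d := by positivity
  -- the weight-two consequence of the weight-`k` hypothesis (for integrability)
  have hg2 : ∀ y, (1 + ‖y‖) ^ 2 * ‖g y‖ ≤ R := fun y => by
    have h1 : (1:ℝ) ≤ 1 + ‖y‖ := by linarith [norm_nonneg y]
    have h2 : (1 + ‖y‖) ^ 2 ≤ (1 + ‖y‖) ^ k := by
      rw [← rpow_two]; exact rpow_le_rpow_of_exponent_le h1 hk2
    exact le_trans (mul_le_mul_of_nonneg_right h2 (norm_nonneg _)) (hg y)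
  have hgk : ∀ y, ‖g y‖ ≤ R * (1 + ‖y‖) ^ (-k) := fun y => by
    have hwpos : 0 < (1 + ‖y‖) ^ k := rpow_pos_of_pos (by linarith [norm_nonneg y]) _
    rw [rpow_neg (by positivity), ← div_eq_mul_inv, le_div_iff₀ hwpos, mul_comm]; exact hg y
  -- bound of `g` on `B(x, 2d) ⊆ B(x, ρ/2)`
  set M : ℝ := (2:ℝ) ^ k * R * ρ ^ (-k) with hM
  have hM0 : 0 ≤ M := by positivity
  have hgM : ∀ y, y ∈ ball x (2 * d) → ‖g y‖ ≤ M := by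
    intro y hy
    have hy' : y ∈ ball x (ρ / 2) := ball_subset_ball (by linarith) hy
    have hw : (1 + ‖y‖) ^ (-k) ≤ (ρ / 2) ^ (-k) := weight_rpow_neg_le_of_mem_ball (by linarith) hy'
    have e : (ρ / 2) ^ (-k) = (2:ℝ) ^ k * ρ ^ (-k) := by
      rw [div_rpow hρ0.le zero_le_two, rpow_neg zero_le_two, rpow_neg hρ0.le]; field_simp
    calc ‖g y‖ ≤ R * (1 + ‖y‖) ^ (-k) := hgk y
      _ ≤ R * (ρ / 2) ^ (-k) := mul_le_mul_of_nonneg_left hw hR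
      _ = M := by rw [e, hM]; ring
  -- the two potentials as integrals of integrable functions; the difference
  have hIx := integrable_fderiv_newtonKernel_smul_of_sq_weight hgm hg2 a x
  have hIx' := integrable_fderiv_newtonKernel_smul_of_sq_weight hgm hg2 a x'
  have hdiff : newtonGradPotential a g x - newtonGradPotential a g x' =
      ∫ y, (fderiv ℝ newtonKernel (x - y) a - fderiv ℝ newtonKernel (x' - y) a) • g y := by
    unfold newtonGradPotential
    rw [← integral_sub hIx hIx']
    exact integral_congr_ae (Eventually.of_forall fun y => by simp only [sub_smul])
  rw [hdiff]
  refine (norm_integral_le_lintegral_norm _).trans ?_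
  set Φ : EuclideanSpace ℝ (Fin 3) → ℝ≥0∞ :=
    fun y => ENNReal.ofReal ‖(fderiv ℝ newtonKernel (x - y) a - fderiv ℝ newtonKernel (x' - y) a) • g y‖ with hΦ
  set B : Set (EuclideanSpace ℝ (Fin 3)) := ball x (2 * d) with hB
  have hBm : MeasurableSet B := measurableSet_ball
  -- NEAR: `∫_B Φ ≤ (‖a‖/4π) M V (2d + 3d)`
  set c₁ : ℝ := ‖a‖ / (4 * π) * M with hc₁
  have hc₁0 : 0 ≤ c₁ := by positivity
  have hmeas1 : Measurable fun y : EuclideanSpace ℝ (Fin 3) => ENNReal.ofReal (c₁ * ‖x - y‖ ^ (-(2:ℝ))) :=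
    (measurable_const.mul ((continuous_const.sub continuous_id).norm.measurable.pow_const _)).ennreal_ofReal
  have hnear : ∫⁻ y in B, Φ y ≤ ENNReal.ofReal (c₁ * (V * (2 * d))) + ENNReal.ofReal (c₁ * (V * (3 * d))) := by
    have hpt : ∀ y ∈ B, Φ y ≤ ENNReal.ofReal (c₁ * ‖x - y‖ ^ (-(2:ℝ))) + ENNReal.ofReal (c₁ * ‖x' - y‖ ^ (-(2:ℝ))) := by
      intro y hy
      rw [hΦ]; dsimp only
      rw [← ENNReal.ofReal_add (by positivity) (by positivity)]
      refine ENNReal.ofReal_le_ofReal ?_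
      have hgy := hgM y hy
      calc ‖(fderiv ℝ newtonKernel (x - y) a - fderiv ℝ newtonKernel (x' - y) a) • g y‖
          ≤ (‖fderiv ℝ newtonKernel (x - y) a‖ + ‖fderiv ℝ newtonKernel (x' - y) a‖) * ‖g y‖ := by
            rw [norm_smul]; exact mul_le_mul_of_nonneg_right (norm_sub_le _ _) (norm_nonneg _)
        _ ≤ (‖a‖ / (4 * π) * ‖x - y‖ ^ (-(2:ℝ)) + ‖a‖ / (4 * π) * ‖x' - y‖ ^ (-(2:ℝ))) * M :=
            mul_le_mul (add_le_add (norm_fderiv_newtonKernel_apply_le _ _) (norm_fderiv_newtonKernel_apply_le _ _))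
              hgy (norm_nonneg _) (by positivity)
        _ = c₁ * ‖x - y‖ ^ (-(2:ℝ)) + c₁ * ‖x' - y‖ ^ (-(2:ℝ)) := by rw [hc₁]; ring
    calc ∫⁻ y in B, Φ y
        ≤ ∫⁻ y in B, (ENNReal.ofReal (c₁ * ‖x - y‖ ^ (-(2:ℝ))) + ENNReal.ofReal (c₁ * ‖x' - y‖ ^ (-(2:ℝ)))) :=
          setLIntegral_mono' hBm hpt
      _ = (∫⁻ y in B, ENNReal.ofReal (c₁ * ‖x - y‖ ^ (-(2:ℝ)))) + ∫⁻ y in B, ENNReal.ofReal (c₁ * ‖x' - y‖ ^ (-(2:ℝ))) :=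
          lintegral_add_left hmeas1 _
      _ ≤ ENNReal.ofReal (c₁ * (V * (2 * d))) + ENNReal.ofReal (c₁ * (V * (3 * d))) := by
          refine add_le_add ?_ ?_
          · -- `∫_{B(x,2d)} |x-y|^{-2} = V · 2d`
            have e : ∫⁻ y in B, ENNReal.ofReal (c₁ * ‖x - y‖ ^ (-(2:ℝ))) =
                ENNReal.ofReal c₁ * ∫⁻ y in ball x (2 * d), ENNReal.ofReal (‖x - y‖ ^ (-(2:ℝ))) := by
              rw [← lintegral_const_mul' _ _ ENNReal.ofReal_ne_top]
              refine lintegral_congr fun y => ?_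
              rw [ENNReal.ofReal_mul hc₁0]
            rw [e, lintegral_ball_comp_sub_left (fun z => ENNReal.ofReal (‖z‖ ^ (-(2:ℝ)))) x (2 * d),
              lintegral_ball_norm_rpow_neg (by norm_num) h2d, ← ENNReal.ofReal_mul hc₁0]
            refine ENNReal.ofReal_le_ofReal (le_of_eq ?_)
            rw [show (3:ℝ) - 2 = 1 by norm_num, rpow_one]; ring
          · -- `B(x,2d) ⊆ B(x',3d)` and `∫_{B(x',3d)} |x'-y|^{-2} = V · 3d`
            have hsub : B ⊆ ball x' (3 * d) := fun y hy => by
              rw [mem_ball, dist_eq_norm] at hy ⊢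
              calc ‖y - x'‖ = ‖(y - x) + (x - x')‖ := by rw [sub_add_sub_cancel]
                _ ≤ ‖y - x‖ + ‖x - x'‖ := norm_add_le _ _
                _ < 2 * d + d := by rw [← hd]; linarith
                _ = 3 * d := by ring
            have h3d : 0 < 3 * d := by positivity
            calc ∫⁻ y in B, ENNReal.ofReal (c₁ * ‖x' - y‖ ^ (-(2:ℝ)))
                ≤ ∫⁻ y in ball x' (3 * d), ENNReal.ofReal (c₁ * ‖x' - y‖ ^ (-(2:ℝ))) := lintegral_mono_set hsub
              _ = ENNReal.ofReal c₁ * ∫⁻ y in ball x' (3 * d), ENNReal.ofReal (‖x' - y‖ ^ (-(2:ℝ))) := by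
                  rw [← lintegral_const_mul' _ _ ENNReal.ofReal_ne_top]
                  refine lintegral_congr fun y => ?_
                  rw [ENNReal.ofReal_mul hc₁0]
              _ = ENNReal.ofReal (c₁ * (V * ((3 * d) ^ (3 - (2:ℝ)) / (3 - (2:ℝ))))) := by
                  rw [lintegral_ball_comp_sub_left (fun z => ENNReal.ofReal (‖z‖ ^ (-(2:ℝ)))) x' (3 * d),
                    lintegral_ball_norm_rpow_neg (by norm_num) h3d, ← ENNReal.ofReal_mul hc₁0]
              _ = ENNReal.ofReal (c₁ * (V * (3 * d))) := by
                  rw [show (3:ℝ) - 2 = 1 by norm_num, rpow_one, div_one]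
  -- FAR: `∫_{Bᶜ} Φ ≤ (8‖a‖/π) d (2d)^{γ-1} R · Cfar V ρ^{1-γ-k}`
  set c₂ : ℝ := 8 * ‖a‖ / π * d * (2 * d) ^ (γ - 1) * R with hc₂
  have hc₂0 : 0 ≤ c₂ := by positivity
  have hfar : ∫⁻ y in Bᶜ, Φ y ≤ ENNReal.ofReal (c₂ * (Cfar * V * ρ ^ (3 - (2 + γ) - k))) := by
    have hpt : ∀ y ∈ Bᶜ, Φ y ≤ ENNReal.ofReal c₂ * ENNReal.ofReal (‖x - y‖ ^ (-(2 + γ)) * (1 + ‖y‖) ^ (-k)) := by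
      intro y hy
      rw [hB, mem_compl_iff, mem_ball, dist_eq_norm, not_lt, norm_sub_rev] at hy
      -- `z = x - y`, `w = x - x'`, `x' - y = z - w`
      have hz0 : x - y ≠ 0 := by
        intro h; rw [h, norm_zero] at hy; linarith
      have hzpos : 0 < ‖x - y‖ := norm_pos_iff.2 hz0
      have hw : ‖x - x'‖ ≤ ‖x - y‖ / 2 := by rw [← hd]; linarith
      have hker : ‖fderiv ℝ newtonKernel (x - y) a - fderiv ℝ newtonKernel (x' - y) a‖ ≤
          8 * ‖a‖ / π * d * (‖x - y‖ ^ 3)⁻¹ := by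
        have h := norm_fderiv_newtonKernel_sub_sub_le hz0 hw
        rw [show x - y - (x - x') = x' - y by abel, norm_sub_rev] at h
        calc ‖fderiv ℝ newtonKernel (x - y) a - fderiv ℝ newtonKernel (x' - y) a‖
            = ‖(fderiv ℝ newtonKernel (x - y) - fderiv ℝ newtonKernel (x' - y)) a‖ := by
              simp only [sub_apply]
          _ ≤ ‖fderiv ℝ newtonKernel (x - y) - fderiv ℝ newtonKernel (x' - y)‖ * ‖a‖ := ContinuousLinearMap.le_opNorm _ _
          _ ≤ 8 * ‖x - x'‖ / (π * ‖x - y‖ ^ 3) * ‖a‖ := mul_le_mul_of_nonneg_right h (norm_nonneg _)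
          _ = 8 * ‖a‖ / π * d * (‖x - y‖ ^ 3)⁻¹ := by rw [hd]; field_simp
      -- `|z|^{-3} ≤ (2d)^{γ-1} |z|^{-(2+γ)}`
      have hz3 : (‖x - y‖ ^ 3)⁻¹ ≤ (2 * d) ^ (γ - 1) * ‖x - y‖ ^ (-(2 + γ)) := by
        have e : (‖x - y‖ ^ 3)⁻¹ = ‖x - y‖ ^ (γ - 1) * ‖x - y‖ ^ (-(2 + γ)) := by
          rw [← rpow_add hzpos, show γ - 1 + -(2 + γ) = -(3:ℝ) by ring, rpow_neg hzpos.le,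
            show (3:ℝ) = ((3:ℕ):ℝ) by norm_num, rpow_natCast]
        rw [e]
        exact mul_le_mul_of_nonneg_right (rpow_le_rpow_of_nonpos h2d hy (by linarith)) (rpow_nonneg hzpos.le _)
      rw [hΦ]; dsimp only
      rw [← ENNReal.ofReal_mul hc₂0]
      refine ENNReal.ofReal_le_ofReal ?_
      rw [norm_smul]
      calc ‖fderiv ℝ newtonKernel (x - y) a - fderiv ℝ newtonKernel (x' - y) a‖ * ‖g y‖
          ≤ (8 * ‖a‖ / π * d * (‖x - y‖ ^ 3)⁻¹) * (R * (1 + ‖y‖) ^ (-k)) :=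
            mul_le_mul hker (hgk y) (norm_nonneg _) (by positivity)
        _ ≤ (8 * ‖a‖ / π * d * ((2 * d) ^ (γ - 1) * ‖x - y‖ ^ (-(2 + γ)))) * (R * (1 + ‖y‖) ^ (-k)) := by
            gcongr
        _ = c₂ * (‖x - y‖ ^ (-(2 + γ)) * (1 + ‖y‖) ^ (-k)) := by rw [hc₂]; ring
    calc ∫⁻ y in Bᶜ, Φ y ≤ ∫⁻ y in Bᶜ, ENNReal.ofReal c₂ * ENNReal.ofReal (‖x - y‖ ^ (-(2 + γ)) * (1 + ‖y‖) ^ (-k)) :=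
          setLIntegral_mono' hBm.compl hpt
      _ = ENNReal.ofReal c₂ * ∫⁻ y in Bᶜ, ENNReal.ofReal (‖x - y‖ ^ (-(2 + γ)) * (1 + ‖y‖) ^ (-k)) :=
          lintegral_const_mul' _ _ ENNReal.ofReal_ne_top
      _ ≤ ENNReal.ofReal c₂ * ∫⁻ y, ENNReal.ofReal (‖x - y‖ ^ (-(2 + γ)) * (1 + ‖y‖) ^ (-k)) :=
          mul_le_mul' le_rfl (setLIntegral_le_lintegral _ _)
      _ ≤ ENNReal.ofReal c₂ * ENNReal.ofReal (Cfar * V * ρ ^ (3 - (2 + γ) - k)) := by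
          refine mul_le_mul' le_rfl ?_
          have h := lintegral_norm_sub_rpow_neg_mul_weight_rpow_neg_le (p := 2 + γ) (k := k) (by linarith) (by linarith)
            (by linarith) hk3 (by linarith) x
          rw [hCfar]; exact h
      _ = ENNReal.ofReal (c₂ * (Cfar * V * ρ ^ (3 - (2 + γ) - k))) := by rw [← ENNReal.ofReal_mul hc₂0]
  -- assemble
  have htot : ∫⁻ y, Φ y ≤ ENNReal.ofReal (c₁ * (V * (2 * d)) + c₁ * (V * (3 * d)) + c₂ * (Cfar * V * ρ ^ (3 - (2 + γ) - k))) := by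
    rw [← lintegral_add_compl Φ hBm, ENNReal.ofReal_add (by positivity) (by positivity),
      ENNReal.ofReal_add (by positivity) (by positivity)]
    exact add_le_add hnear hfar
  refine (ENNReal.toReal_mono ENNReal.ofReal_ne_top htot).trans ?_
  rw [ENNReal.toReal_ofReal (by positivity)]
  -- the algebra: `d ≤ d^γ (ρ/4)^{1-γ}`, `d (2d)^{γ-1} = 2^{γ-1} d^γ`
  have hd4 : d ≤ ρ / 4 := by rw [hd, hρ]; linarith
  have hdγ : d = d ^ γ * d ^ (1 - γ) := by
    rw [← rpow_add hdpos, show γ + (1 - γ) = 1 by ring, rpow_one]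
  have hd1γ : d ^ (1 - γ) ≤ (4:ℝ) ^ (γ - 1) * ρ ^ (1 - γ) := by
    calc d ^ (1 - γ) ≤ (ρ / 4) ^ (1 - γ) := rpow_le_rpow hd0 hd4 (by linarith)
      _ = (4:ℝ) ^ (γ - 1) * ρ ^ (1 - γ) := by
          rw [div_rpow hρ0.le (by norm_num), show γ - 1 = -(1 - γ) by ring, rpow_neg (by norm_num)]; field_simp
  have hnear_alg : c₁ * (V * (2 * d)) + c₁ * (V * (3 * d)) ≤ Cn * ‖a‖ * R * d ^ γ * ρ ^ (1 - γ - k) := by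
    have e1 : c₁ * (V * (2 * d)) + c₁ * (V * (3 * d)) = 5 * (2:ℝ) ^ k * V / (4 * π) * ‖a‖ * R * ρ ^ (-k) * d := by
      rw [hc₁, hM]; ring
    have e2 : Cn * ‖a‖ * R * d ^ γ * ρ ^ (1 - γ - k) =
        5 * (2:ℝ) ^ k * V / (4 * π) * ‖a‖ * R * ρ ^ (-k) * (d ^ γ * ((4:ℝ) ^ (γ - 1) * ρ ^ (1 - γ))) := by
      rw [hCn, show (1:ℝ) - γ - k = -k + (1 - γ) by ring, rpow_add hρ0]; ring
    rw [e1, e2]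
    refine mul_le_mul_of_nonneg_left ?_ (by positivity)
    calc d = d ^ γ * d ^ (1 - γ) := hdγ
      _ ≤ d ^ γ * ((4:ℝ) ^ (γ - 1) * ρ ^ (1 - γ)) := mul_le_mul_of_nonneg_left hd1γ (rpow_nonneg hd0 _)
  have hfar_alg : c₂ * (Cfar * V * ρ ^ (3 - (2 + γ) - k)) = Cf * ‖a‖ * R * d ^ γ * ρ ^ (1 - γ - k) := by
    have e1 : d * (2 * d) ^ (γ - 1) = (2:ℝ) ^ (γ - 1) * d ^ γ := by
      rw [mul_rpow zero_le_two hd0, show d ^ γ = d ^ (1:ℝ) * d ^ (γ - 1) by rw [← rpow_add hdpos]; congr 1; ring,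
        rpow_one]; ring
    rw [hc₂, hCf, show (3:ℝ) - (2 + γ) - k = 1 - γ - k by ring,
      show 8 * ‖a‖ / π * d * (2 * d) ^ (γ - 1) * R = 8 / π * ‖a‖ * R * (d * (2 * d) ^ (γ - 1)) by ring, e1]
    ring
  calc c₁ * (V * (2 * d)) + c₁ * (V * (3 * d)) + c₂ * (Cfar * V * ρ ^ (3 - (2 + γ) - k))
      ≤ Cn * ‖a‖ * R * d ^ γ * ρ ^ (1 - γ - k) + Cf * ‖a‖ * R * d ^ γ * ρ ^ (1 - γ - k) := by
        rw [← hfar_alg]; exact add_le_add hnear_alg le_rfl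
    _ = (Cn + Cf) * ‖a‖ * R * ‖x - x'‖ ^ γ * (1 + ‖x‖) ^ (1 - γ - k) := by rw [hd, hρ]; ring

end Banach

end Summit.NavierStokesRegularity.NavierStokesRegularity.Theorems.KelvinGate

end
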